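import Summits.AnomalousDissipation.AnomalousDissipation.Theorems.SawtoothPulseCascadeK1LocalisedCascadeAffinePair

/-!
# K1loc, line `Spectral` — S-D (first good piece): ROW AND COLUMN CONES OF THE ITINERARY COCYCLE

Helper file of the prover lane on the crux `K1LocalisedCascade` (stmt-AnomalousDissipation-19491), route
`SawtoothPulseCascade`, registered line `Cruxes.K1LocalisedCascade.Spectral` (one open stub `stub_highModeConcentration`).
The per-line refinement of the analytic first good piece (memo v8 §7–§8, route (i)) appends phases on the INSIDE of the itinerary:
`itinJac γ (L ++ [p]) = itinJac γ L · A(p)` (`…K1Start.itinJac_append_pair`).  Its potential needs the growth of the horizontal cell frequency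
`(itinJac γ L)₀₀` under appending, and its H-cut needs the slope `(itinJac γ L)₁₀` to be small against `(itinJac γ L)₀₀`.  Both follow from the
tree's cone lemma `itinJac_growth_two` (Part 7) once rows are turned into columns:

* `transpose_pulseJac`, `transpose_itinJac` — `A(r,s)ᵀ = A(s,r)` and `(itinJac γ L)ᵀ = itinJac γ (L.reverse.map swap)` (a sign list again);
* `col_cone_itinJac` — the first column is in the unstable cone: `γ|(itinJac γ L)₁₀| ≤ 2|(itinJac γ L)₀₀|` and `|(itinJac γ L)₀₀| ≥ (γ²−3)^{|L|}`;
* `row_cone_itinJac` — the first row likewise: `γ|(itinJac γ L)₀₁| ≤ 2|(itinJac γ L)₀₀|`;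
* `abs_itinJac_append_entry_ge` — **`|(itinJac γ (L ++ [p]))₀₀| ≥ (γ² − 3)|(itinJac γ L)₀₀|`** for sign pairs `p` and `γ² ≥ 8`
  (the per-phase gain of the potential `Q` of memo v8 §7), and `abs_sub_mul_itinJac_ge` — `|(itinJac γ L)₁₀ − γσ(itinJac γ L)₀₀| ≥ (γ − 2/γ)|(itinJac γ L)₀₀|`
  (the H-cut slope is non-degenerate).

[cite: ElgindiLissMattingly2025, §1.2.2 and §3.1 Lemma 3.1 (cone invariance of the cocycle)] [problem: turb]
-/

-- `Summit.<Summit>.<Problem>`: single-conjunct summit, the duplicate namespace segment is deliberate.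
set_option linter.dupNamespace false

noncomputable section

namespace Summit.AnomalousDissipation.AnomalousDissipation.Theorems.SawtoothPulseCascade.K1Start

open Matrix
open Literature.Analysis.FluidPDE.SawtoothCascade

/-! ## §1 Transposes -/

/-- `A(r,s)ᵀ = A(s,r)`. [cite: ElgindiLissMattingly2025, §1.2.2] -/
theorem transpose_pulseJac (γ r s : ℝ) : (pulseJac γ r s)ᵀ = pulseJac γ s r := by
  ext i j; fin_cases i <;> fin_cases j <;> simp [pulseJac, mul_comm]

/-- `(Π A(rᵢ,sᵢ))ᵀ = Π A(sᵢ,rᵢ)` over the reversed list. [cite: ElgindiLissMattingly2025, §1.2.2] -/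
theorem transpose_itinJac (γ : ℝ) (L : List (ℝ × ℝ)) :
    (itinJac γ L)ᵀ = itinJac γ (L.reverse.map Prod.swap) := by
  induction L with
  | nil => simp [itinJac]
  | cons p L ih =>
    rw [itinJac, Matrix.transpose_mul, ih, transpose_pulseJac, List.reverse_cons, List.map_append, List.map_singleton,
      itinJac_append_pair]
    rfl

/-- The reversed-swapped list of a sign list is a sign list of the same length. [folklore] -/
theorem isSignList_reverse_swap {L : List (ℝ × ℝ)} (hL : IsSignList L) :
    IsSignList (L.reverse.map Prod.swap) ∧ (L.reverse.map Prod.swap).length = L.length := by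
  refine ⟨fun q hq => ?_, by simp⟩
  obtain ⟨p, hp, rfl⟩ := List.mem_map.1 hq
  have h := hL p (List.mem_reverse.1 hp)
  exact ⟨h.2, h.1⟩

/-! ## §2 Column and row cones -/

/-- **The first column of the cocycle is a cone vector**: `γ|(itinJac γ L)₁₀| ≤ 2|(itinJac γ L)₀₀|` and
`|(itinJac γ L)₀₀| ≥ (γ²−3)^{|L|}` (`itinJac_growth_two` on `e₀`). [cite: ElgindiLissMattingly2025, §3.1 Lemma 3.1] -/
theorem col_cone_itinJac {γ : ℝ} (hγ : 0 < γ) (h8 : 8 ≤ γ ^ 2) {L : List (ℝ × ℝ)} (hL : IsSignList L) :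
    γ * |itinJac γ L 1 0| ≤ 2 * |itinJac γ L 0 0| ∧ (γ ^ 2 - 3) ^ L.length ≤ |itinJac γ L 0 0| := by
  have hv : γ * |(Pi.single 0 1 : Fin 2 → ℝ) 1| ≤ 2 * |(Pi.single 0 1 : Fin 2 → ℝ) 0| := by simp
  have h := itinJac_growth_two hγ h8 hL hv
  simpa [Matrix.mulVec_single_one] using h

/-- **The first row of the cocycle is a cone vector**: `γ|(itinJac γ L)₀₁| ≤ 2|(itinJac γ L)₀₀|` (the column cone of the transpose).
[cite: ElgindiLissMattingly2025, §3.1 Lemma 3.1] -/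
theorem row_cone_itinJac {γ : ℝ} (hγ : 0 < γ) (h8 : 8 ≤ γ ^ 2) {L : List (ℝ × ℝ)} (hL : IsSignList L) :
    γ * |itinJac γ L 0 1| ≤ 2 * |itinJac γ L 0 0| := by
  have h := (col_cone_itinJac hγ h8 (isSignList_reverse_swap hL).1).1
  rw [← transpose_itinJac] at h
  simpa [Matrix.transpose_apply] using h

/-! ## §3 Appending a phase: growth of the cell frequency, non-degeneracy of the H-slope -/

/-- **Per-phase gain of the potential**: for a sign list `L`, a sign pair `(r, s)` and `γ² ≥ 8`:
`|(itinJac γ (L ++ [(r,s)]))₀₀| ≥ (γ² − 3)|(itinJac γ L)₀₀|` (row cone of `L`: the new entry is `J₀₀(1 + rsγ²) + J₀₁ sγ`).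
[cite: ElgindiLissMattingly2025, §3.1 Lemma 3.1] -/
theorem abs_itinJac_append_entry_ge {γ : ℝ} (hγ : 0 < γ) (h8 : 8 ≤ γ ^ 2) {L : List (ℝ × ℝ)} (hL : IsSignList L) {r s : ℝ}
    (hr : r = 1 ∨ r = -1) (hs : s = 1 ∨ s = -1) :
    (γ ^ 2 - 3) * |itinJac γ L 0 0| ≤ |itinJac γ (L ++ [(r, s)]) 0 0| := by
  have hrow := row_cone_itinJac hγ h8 hL
  rw [itinJac_append_pair]
  have e : (itinJac γ L * pulseJac γ r s) 0 0 = itinJac γ L 0 0 * (1 + r * s * γ ^ 2) + itinJac γ L 0 1 * (s * γ) := by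
    simp [Matrix.mul_apply, Fin.sum_univ_two, pulseJac]
  rw [e]
  have hrs : r * s = 1 ∨ r * s = -1 := by
    rcases hr with rfl | rfl <;> rcases hs with rfl | rfl <;> norm_num
  have hs1 : |s| = 1 := by rcases hs with rfl | rfl <;> norm_num
  set a := itinJac γ L 0 0
  set b := itinJac γ L 0 1
  have hb : |b * (s * γ)| ≤ 2 * |a| := by
    rw [abs_mul, abs_mul, hs1, one_mul, abs_of_pos hγ, mul_comm]; exact hrow
  have hmain : |a| * (γ ^ 2 - 1) ≤ |a * (1 + r * s * γ ^ 2)| := by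
    rw [abs_mul]
    refine mul_le_mul_of_nonneg_left ?_ (abs_nonneg a)
    rcases hrs with h | h <;> rw [h] <;> [rw [abs_of_pos (by nlinarith)]; rw [abs_of_neg (by nlinarith)]] <;> nlinarith
  calc (γ ^ 2 - 3) * |a| = |a| * (γ ^ 2 - 1) - 2 * |a| := by ring
    _ ≤ |a * (1 + r * s * γ ^ 2)| - |b * (s * γ)| := by linarith
    _ ≤ |a * (1 + r * s * γ ^ 2) + b * (s * γ)| := by
        have := abs_sub_abs_le_abs_sub (a * (1 + r * s * γ ^ 2)) (-(b * (s * γ)))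
        rw [abs_neg, sub_neg_eq_add] at this
        exact this

/-- **The H-cut slope is non-degenerate**: `|(itinJac γ L)₁₀ − γσ(itinJac γ L)₀₀| ≥ (γ − 2/γ)|(itinJac γ L)₀₀|` for `|σ| = 1`
(column cone). [cite: ElgindiLissMattingly2025, §3.1 Lemma 3.1] -/
theorem abs_sub_mul_itinJac_ge {γ : ℝ} (hγ : 0 < γ) (h8 : 8 ≤ γ ^ 2) {L : List (ℝ × ℝ)} (hL : IsSignList L) {σ : ℝ}
    (hσ : σ = 1 ∨ σ = -1) :
    (γ - 2 / γ) * |itinJac γ L 0 0| ≤ |itinJac γ L 1 0 - γ * σ * itinJac γ L 0 0| := by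
  have hcol := (col_cone_itinJac hγ h8 hL).1
  set a := itinJac γ L 0 0
  set c := itinJac γ L 1 0
  have hσ1 : |σ| = 1 := by rcases hσ with rfl | rfl <;> norm_num
  have h1 : |γ * σ * a| = γ * |a| := by rw [abs_mul, abs_mul, hσ1, abs_of_pos hγ, mul_one]
  have h2 : |c| ≤ 2 / γ * |a| := by
    rw [div_mul_eq_mul_div, le_div_iff₀ hγ, mul_comm]; exact hcol
  calc (γ - 2 / γ) * |a| = γ * |a| - 2 / γ * |a| := by ring
    _ ≤ |γ * σ * a| - |c| := by rw [h1]; linarith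
    _ ≤ |γ * σ * a - c| := abs_sub_abs_le_abs_sub _ _
    _ = |c - γ * σ * a| := abs_sub_comm _ _

end Summit.AnomalousDissipation.AnomalousDissipation.Theorems.SawtoothPulseCascade.K1Start
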